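import Literature.MathematicalPhysics.QuantumFieldTheory.Balaban1983to89.Beta.PlaquetteStencil
import Literature.MathematicalPhysics.QuantumFieldTheory.Balaban1983to89.Beta.WilsonVertexKron

/-!
# The product-chart frame of an axis reflection on bond coordinates and colour-supported test vectors

HONEST FRAMING.  Discharging `BetaPertH` makes Balaban's ultraviolet stability UNCONDITIONAL — a real constructive-QFT
result; it is NOT the continuum limit and NOT the Clay problem.  This leaf is bookkeeping toward the Wilson piece of the
background-covariance-with-contact of the one-step jet (cell pub-balaban, β sub-cell, lane an3; demand X-an2-45 §3 (ii)):
finite-dimensional linear algebra over an arbitrary finite abelian lattice, no estimate, no limit, nothing cited —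
every statement is kernel-proved here ([folklore] = standard finite algebra, no published theorem is being quoted).

OBJECTS (all "definitions asserting nothing").  For a site map `σ : Λ → Λ` reflecting the axis `α` of the frame `e : D → Λ`
(frame laws `σ(x + e_κ) = σ x + e_κ` for `κ ≠ α`, `σ(x + e_α) = σ x − e_α`): the bond sign `sgn α κ = −1 ↔ κ = α`, the reflected
base site `rsite` / reflected bond `rpt` (involutive: `rsite_rsite`, `rpt_rpt`), the reflection on coloured coordinates
`pullv` and on colourless ones `pullv₀`, the colour-supported test vector `cvec a φ`, the CONTACT COEFFICIENT `Lc e α u p`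
(an explicit combination of Kronecker deltas: the summed `α`-row curl difference of the indicator bond field of `p` behind ∕ at
the background site `u`), the CONTACT FUNCTIONAL `ctF`, and the ANTISYMMETRISED COLOURLESS WILSON STENCIL
`S₀A e z γ p q = ½ (w p q − w q p)`, `w = WilsonVertexKron.wilsonStencil₀` (on `ℤ^(d+1)`, `e = unitVec`, its entries are the field
block of `StepJetData.wilsonA`, by `WilsonVertexKron.wilsonStencil₀_apply_eq_unit`).

RESULTS.  The Kronecker form of `PlaquetteStencil.wilsonVertex₁` on colour-supported vectors (`cvec_wilsonVertex₁_cvec`: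
`cvec a φ ⬝ᵥ W(A) (cvec b ψ) = A_{ab} · φ ⬝ᵥ w ψ`), the reflection of colour-supported ∕ delta vectors (`pullv_cvec`,
`pullv₀_single`), and the contact functional at two colour-supported vectors (`ctF_cvec_add_cvec`, `Lfun_single`).  (The
non-degenerate colour witness that strips the colour from the quadratic-form reflection law lives downstream, in
`WilsonStencilReflection`, over the real quaternions — no matrix-norm instances are needed anywhere in this leaf.)
-/

namespace Summit.QuantumFields.BalabanUV.Beta.WilsonReflectionFrame

open Literature.MathematicalPhysics.QuantumFieldTheory.Balaban1983to89.Beta.PlaquetteVertex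
open Literature.MathematicalPhysics.QuantumFieldTheory.Balaban1983to89.Beta.PlaquetteStencil (wilsonVertex₁)
open Literature.MathematicalPhysics.QuantumFieldTheory.Balaban1983to89.Beta.WilsonVertexKron (wilsonStencil₀
  wilsonVertex₁_apply_eq_mul)
open scoped Matrix

/-! ## §1 Reflected bonds, signs, the contact coefficient, the antisymmetrised colourless stencil (no finiteness of `Λ`) -/

section Objects

variable {Λ : Type*} [AddCommGroup Λ] [DecidableEq Λ] {D : Type*} [Fintype D] [DecidableEq D]

/-- THE BOND SIGN of the axis reflection in the product chart: `−1` on bonds parallel to the reflected axis `α`, `+1` on the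
others.  A definition asserting nothing. [folklore] -/
def sgn (α κ : D) : ℝ := if κ = α then -1 else 1

/-- THE REFLECTED BASE SITE of a bond of direction `κ` based at `x` under the site map `σ` reflecting the axis `α` (frame `e`):
`σ x`, pulled back by `e α` when the bond is parallel to the axis (the image bond `σx → σx − e_α` is based at its far end).
A definition asserting nothing. [folklore] -/
def rsite (σ : Λ → Λ) (e : D → Λ) (α κ : D) (x : Λ) : Λ := σ x - if κ = α then e α else 0

/-- the reflected bond as a point of `Λ × D`.  A definition asserting nothing. [folklore] -/
def rpt (σ : Λ → Λ) (e : D → Λ) (α : D) (p : Λ × D) : Λ × D := (rsite σ e α p.2 p.1, p.2)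

/-- **THE CONTACT COEFFICIENT** `Lc e α u (x, κ)`: the summed `α`-row difference of the curl of the INDICATOR bond field of
`(x, κ)` between the plaquettes behind and at the background site `u` —
`Σ_ν (lcurl e δ_{(x,κ)} (u − e_ν) ν α − lcurl e δ_{(x,κ)} u ν α)`; an explicit finite combination of Kronecker deltas
(`lcurl` unfolds it), meaningful on every abelian group `Λ`.  A definition asserting nothing. [folklore] -/
def Lc (e : D → Λ) (α : D) (u : Λ) (p : Λ × D) : ℝ :=
  ∑ ν, (lcurl e (bondLetter p.1 p.2 (1 : ℝ)) (u - e ν) ν α - lcurl e (bondLetter p.1 p.2 (1 : ℝ)) u ν α)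

/-- **THE ANTISYMMETRISED COLOURLESS WILSON STENCIL** `S₀A e z γ p q := ½·(w(p,q) − w(q,p))`, `w = WilsonVertexKron.wilsonStencil₀`
(on `ℤ^{d+1}` with `e := unitVec` its entries are an2's `StepJetData.wilsonA` field block, by `wilsonStencil₀_apply_eq_unit`).
A definition asserting nothing. [folklore] -/
noncomputable def S₀A (e : D → Λ) (z : Λ) (γ : D) (p q : Λ × D) : ℝ :=
  (1 / 2) * (wilsonStencil₀ e z γ p q - wilsonStencil₀ e z γ q p)

omit [Fintype D] in
/-- `sgn² = 1`. [folklore] -/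
theorem sgn_mul_self (α κ : D) : sgn α κ * sgn α κ = 1 := by
  unfold sgn; split_ifs <;> norm_num

omit [Fintype D] in
/-- `sgn α α = −1`. [folklore] -/
@[simp] theorem sgn_self (α : D) : sgn α α = -1 := by simp [sgn]

omit [Fintype D] in
/-- `sgn α κ = 1` off the axis. [folklore] -/
theorem sgn_of_ne {α κ : D} (h : κ ≠ α) : sgn α κ = 1 := by simp [sgn, h]

/-- `S₀A` is antisymmetric. [folklore] -/
theorem S₀A_swap (e : D → Λ) (z : Λ) (γ : D) (p q : Λ × D) : S₀A e z γ q p = -S₀A e z γ p q := by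
  unfold S₀A; ring

variable {σ : Λ → Λ} {e : D → Λ} {α : D}

omit [DecidableEq Λ] [Fintype D] [DecidableEq D] in
/-- the frame law on the reflected axis, read backwards: `σ(x − e_α) = σx + e_α`. [folklore] -/
theorem refl_sub (h₂ : ∀ x, σ (x + e α) = σ x - e α) (x : Λ) : σ (x - e α) = σ x + e α := by
  have h := h₂ (x - e α)
  rw [sub_add_cancel] at h
  rw [h, sub_add_cancel]

omit [DecidableEq Λ] [Fintype D] in
/-- `rsite` is an involution (for `σ` an involution obeying the reflected frame law). [folklore] -/
theorem rsite_rsite (hσ : Function.Involutive σ) (h₂ : ∀ x, σ (x + e α) = σ x - e α) (κ : D) (x : Λ) :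
    rsite σ e α κ (rsite σ e α κ x) = x := by
  unfold rsite
  split_ifs with h
  · rw [refl_sub h₂, hσ x, add_sub_cancel_right]
  · rw [sub_zero, sub_zero, hσ x]

omit [DecidableEq Λ] [Fintype D] in
/-- `rpt` is an involution. [folklore] -/
theorem rpt_rpt (hσ : Function.Involutive σ) (h₂ : ∀ x, σ (x + e α) = σ x - e α) (p : Λ × D) :
    rpt σ e α (rpt σ e α p) = p := by
  obtain ⟨x, κ⟩ := p
  simp only [rpt]
  rw [rsite_rsite hσ h₂]

omit [DecidableEq Λ] [Fintype D] in
/-- `rsite κ x = u ↔ x = rsite κ u`. [folklore] -/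
theorem rsite_eq_iff (hσ : Function.Involutive σ) (h₂ : ∀ x, σ (x + e α) = σ x - e α) (κ : D) (x u : Λ) :
    rsite σ e α κ x = u ↔ x = rsite σ e α κ u :=
  ⟨fun h => by rw [← h, rsite_rsite hσ h₂], fun h => by rw [h, rsite_rsite hσ h₂]⟩

omit [DecidableEq Λ] [Fintype D] in
/-- `rpt q = p ↔ q = rpt p`. [folklore] -/
theorem rpt_eq_iff (hσ : Function.Involutive σ) (h₂ : ∀ x, σ (x + e α) = σ x - e α) (p q : Λ × D) :
    rpt σ e α q = p ↔ q = rpt σ e α p :=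
  ⟨fun h => by rw [← h, rpt_rpt hσ h₂], fun h => by rw [h, rpt_rpt hσ h₂]⟩

end Objects

/-! ## §2 The reflection on coordinates, the contact functional, homogeneity -/

section Coordinates

variable {𝔸 : Type*} [Ring 𝔸] [Algebra ℝ 𝔸]
variable {Λ : Type*} [AddCommGroup Λ] [DecidableEq Λ] {C : Type*} [Fintype C] {D : Type*} [Fintype D] [DecidableEq D]

/-- THE REFLECTION ON COORDINATES: `(pullv v)(x,(a,κ)) = sgn α κ · v(rsite κ x, (a,κ))` — a signed permutation of the coordinates.
A definition asserting nothing. [folklore] -/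
def pullv (σ : Λ → Λ) (e : D → Λ) (α : D) (v : Λ × (C × D) → ℝ) : Λ × (C × D) → ℝ :=
  fun p => sgn α p.2.2 * v (rsite σ e α p.2.2 p.1, p.2)

/-- THE CONTACT FUNCTIONAL of a colour matrix `A` at the background site `u`:
`ctF e α u A v := Σ_a (Σ_ν (lcurl e v_a (u − e_ν) ν α − lcurl e v_a u ν α)) · Σ_b A_{ab} v(u,(b,α))` (`v_a = coords v · · a`).
A definition asserting nothing. [folklore] -/
def ctF (e : D → Λ) (α : D) (u : Λ) (A : Matrix C C ℝ) (v : Λ × (C × D) → ℝ) : ℝ :=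
  ∑ a, (∑ ν, (lcurl e (coords v) (u - e ν) ν α a - lcurl e (coords v) u ν α a)) * ∑ b, A a b * v (u, (b, α))

omit [Fintype C] [Fintype D] in
/-- `adM` is homogeneous in the letter. [folklore] -/
theorem adM_smul [DecidableEq C] (τ : 𝔸 →ₗ[ℝ] ℝ) (t : C → 𝔸) (c : ℝ) (F : 𝔸) : adM τ t (c • F) = c • adM τ t F := by
  ext a b
  simp only [adM_apply, Matrix.smul_apply, smul_mul_assoc, map_smul, smul_eq_mul]

omit [Fintype C] in
/-- the Wilson vertex is homogeneous in the colour matrix. [folklore] -/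
theorem wilsonVertex₁_smul (e : D → Λ) (z : Λ) (γ : D) (c : ℝ) (A : Matrix C C ℝ) :
    wilsonVertex₁ e z γ (c • A) = c • wilsonVertex₁ e z γ A := by
  ext ⟨x, a, μ⟩ ⟨y, b, ν⟩
  rw [Matrix.smul_apply, wilsonVertex₁_apply_eq_mul, wilsonVertex₁_apply_eq_mul, Matrix.smul_apply, smul_eq_mul, smul_eq_mul,
    mul_assoc]

end Coordinates

/-! ## §3 Colour-supported test vectors and the Kronecker form of the Wilson vertex -/

section TestVectors

variable {Λ : Type*} [Fintype Λ] [DecidableEq Λ] [AddCommGroup Λ] {C : Type*} [Fintype C] [DecidableEq C]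
  {D : Type*} [Fintype D] [DecidableEq D] {σ : Λ → Λ} {e : D → Λ} {α : D}

/-- THE COLOUR-SUPPORTED TEST VECTOR: the colourless vector `φ` on `Λ × D` placed in colour `a`.  A definition asserting nothing.
[folklore] -/
def cvec (a : C) (φ : Λ × D → ℝ) : Λ × (C × D) → ℝ := fun P => if P.2.1 = a then φ (P.1, P.2.2) else 0

/-- THE REFLECTION ON COLOURLESS VECTORS: `(pullv₀ φ)(p) = sgn α p.2 · φ(rpt p)`.  A definition asserting nothing. [folklore] -/
def pullv₀ (σ : Λ → Λ) (e : D → Λ) (α : D) (φ : Λ × D → ℝ) : Λ × D → ℝ := fun p => sgn α p.2 * φ (rpt σ e α p)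

omit [Fintype Λ] [DecidableEq Λ] [AddCommGroup Λ] [DecidableEq C] [Fintype D] [DecidableEq D] in
/-- reindexing `Λ × (C × D)` with the colour innermost. [folklore] -/
theorem sum_reindex₃ [Fintype Λ] [Fintype D] (F : Λ × (C × D) → ℝ) : ∑ P, F P = ∑ p : Λ × D, ∑ a, F (p.1, (a, p.2)) := by
  simp only [Fintype.sum_prod_type]
  exact Finset.sum_congr rfl fun x _ => Finset.sum_comm

omit [DecidableEq Λ] [AddCommGroup Λ] [DecidableEq D] in
/-- pairing with a colour-supported vector. [folklore] -/
theorem cvec_dotProduct (a : C) (φ : Λ × D → ℝ) (W : Λ × (C × D) → ℝ) : cvec a φ ⬝ᵥ W = ∑ p, φ p * W (p.1, (a, p.2)) := by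
  rw [dotProduct, sum_reindex₃]
  simp only [cvec, Prod.mk.eta, ite_mul, zero_mul, Finset.sum_ite_eq', Finset.mem_univ, if_true]

omit [DecidableEq Λ] [AddCommGroup Λ] [DecidableEq D] in
/-- a matrix applied to a colour-supported vector. [folklore] -/
theorem mulVec_cvec (K : Matrix (Λ × (C × D)) (Λ × (C × D)) ℝ) (b : C) (ψ : Λ × D → ℝ) (P : Λ × (C × D)) :
    (K *ᵥ cvec b ψ) P = ∑ q, K P (q.1, (b, q.2)) * ψ q := by
  rw [Matrix.mulVec, dotProduct, sum_reindex₃]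
  simp only [cvec, Prod.mk.eta, mul_ite, mul_zero, Finset.sum_ite_eq', Finset.mem_univ, if_true]

/-- **THE KRONECKER FORM OF THE WILSON VERTEX ON COLOUR-SUPPORTED VECTORS**:
`cvec a φ ⬝ᵥ (wilsonVertex₁ e z γ A) (cvec b ψ) = A_{ab} · φ ⬝ᵥ wilsonStencil₀ e z γ ψ` (`WilsonVertexKron.wilsonVertex₁_apply_eq_mul`).
[folklore] -/
theorem cvec_wilsonVertex₁_cvec (e : D → Λ) (z : Λ) (γ : D) (A : Matrix C C ℝ) (a b : C) (φ ψ : Λ × D → ℝ) :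
    cvec a φ ⬝ᵥ (wilsonVertex₁ e z γ A *ᵥ cvec b ψ) = A a b * (φ ⬝ᵥ (wilsonStencil₀ e z γ *ᵥ ψ)) := by
  rw [cvec_dotProduct, dotProduct, Finset.mul_sum]
  refine Finset.sum_congr rfl fun p _ => ?_
  rw [mulVec_cvec, Matrix.mulVec, dotProduct, Finset.mul_sum, Finset.mul_sum, Finset.mul_sum]
  refine Finset.sum_congr rfl fun q _ => ?_
  rw [wilsonVertex₁_apply_eq_mul, Prod.mk.eta, Prod.mk.eta]
  ring

omit [Fintype Λ] [DecidableEq Λ] [Fintype C] [Fintype D] in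
/-- the reflection of a colour-supported vector is colour-supported. [folklore] -/
theorem pullv_cvec (a : C) (φ : Λ × D → ℝ) : pullv σ e α (cvec a φ) = cvec a (pullv₀ σ e α φ) := by
  funext P
  simp only [pullv, cvec, pullv₀, rpt]
  split_ifs <;> simp

omit [Fintype Λ] [DecidableEq Λ] [Fintype C] [DecidableEq C] [Fintype D] in
/-- the reflection on coordinates is additive. [folklore] -/
theorem pullv_add (v w : Λ × (C × D) → ℝ) : pullv σ e α (v + w) = pullv σ e α v + pullv σ e α w := by
  funext P; simp only [pullv, Pi.add_apply, mul_add]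

omit [Fintype Λ] [Fintype C] [DecidableEq C] [Fintype D] in
/-- the reflection of a colourless delta vector: `pullv₀ δ_p = sgn α p.2 • δ_{rpt p}`. [folklore] -/
theorem pullv₀_single (hσ : Function.Involutive σ) (h₂ : ∀ x, σ (x + e α) = σ x - e α) (p : Λ × D) :
    pullv₀ σ e α (Pi.single p 1) = sgn α p.2 • Pi.single (rpt σ e α p) 1 := by
  funext q
  simp only [pullv₀, Pi.single_apply, Pi.smul_apply, smul_eq_mul, mul_ite, mul_one, mul_zero, rpt_eq_iff hσ h₂]
  by_cases h : q = rpt σ e α p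
  · rw [if_pos h, if_pos h, h]; rfl
  · rw [if_neg h, if_neg h]

omit [AddCommGroup Λ] [Fintype C] [DecidableEq C] in
/-- the bilinear form of a matrix at two scaled delta vectors. [folklore] -/
theorem smul_single_dotProduct_mulVec_smul_single (S : Matrix (Λ × D) (Λ × D) ℝ) (c d : ℝ) (p q : Λ × D) :
    (c • Pi.single p (1 : ℝ)) ⬝ᵥ (S *ᵥ (d • Pi.single q (1 : ℝ))) = c * d * S p q := by
  rw [Matrix.mulVec_smul, smul_dotProduct, dotProduct_smul, Matrix.mulVec_single_one, single_one_dotProduct, Matrix.col_apply,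
    smul_eq_mul, smul_eq_mul, mul_assoc]

omit [Fintype Λ] [DecidableEq Λ] [Fintype C] [Fintype D] [DecidableEq D] in
/-- the curl of a colour-supported vector in coordinates. [folklore] -/
theorem lcurl_coords_cvec (a a' : C) (φ : Λ × D → ℝ) (z : Λ) (μ ν : D) :
    lcurl e (coords (cvec a φ)) z μ ν a' = if a' = a then lcurl e (fun x κ => φ (x, κ)) z μ ν else 0 := by
  simp only [lcurl, coords, cvec, Pi.sub_apply]
  split_ifs <;> simp

omit [Fintype Λ] [Fintype C] [DecidableEq C] in
/-- THE COLOURLESS CONTACT FUNCTIONAL `L φ := Σ_ν (lcurl e φ (u − e_ν) ν α − lcurl e φ u ν α)` at a delta vector is the contact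
coefficient: `L δ_p = Lc e α u p`. [folklore] -/
theorem Lfun_single (u : Λ) (p : Λ × D) :
    (∑ ν, (lcurl e (fun x κ => (Pi.single p (1 : ℝ) : Λ × D → ℝ) (x, κ)) (u - e ν) ν α -
      lcurl e (fun x κ => (Pi.single p (1 : ℝ) : Λ × D → ℝ) (x, κ)) u ν α)) = Lc e α u p := by
  have h : (fun x κ => (Pi.single p (1 : ℝ) : Λ × D → ℝ) (x, κ)) = bondLetter p.1 p.2 (1 : ℝ) := by
    funext x κ
    simp only [Pi.single_apply, bondLetter, Prod.ext_iff]
  rw [h]; rfl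

omit [Fintype Λ] [DecidableEq Λ] [DecidableEq D] in
/-- **THE CONTACT FUNCTIONAL AT TWO COLOUR-SUPPORTED VECTORS.** [folklore] -/
theorem ctF_cvec_add_cvec (u : Λ) (A : Matrix C C ℝ) (a b : C) (φ ψ : Λ × D → ℝ) :
    ctF e α u A (cvec a φ + cvec b ψ) =
      (∑ ν, (lcurl e (fun x κ => φ (x, κ)) (u - e ν) ν α - lcurl e (fun x κ => φ (x, κ)) u ν α)) *
          (A a a * φ (u, α) + A a b * ψ (u, α)) +
        (∑ ν, (lcurl e (fun x κ => ψ (x, κ)) (u - e ν) ν α - lcurl e (fun x κ => ψ (x, κ)) u ν α)) *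
          (A b a * φ (u, α) + A b b * ψ (u, α)) := by
  have hc : coords (cvec a φ + cvec b ψ) = coords (cvec a φ) + coords (cvec b ψ) := rfl
  have hin : ∀ a', (∑ b', A a' b' * (cvec a φ + cvec b ψ) (u, (b', α))) = A a' a * φ (u, α) + A a' b * ψ (u, α) := by
    intro a'
    simp only [Pi.add_apply, cvec, mul_add, Finset.sum_add_distrib, mul_ite, mul_zero, Finset.sum_ite_eq', Finset.mem_univ,
      if_true]
  simp only [ctF]
  simp only [hin]
  simp only [hc, lcurl_add, Pi.add_apply, lcurl_coords_cvec]
  have hsplit : ∀ a', (∑ ν, ((if a' = a then lcurl e (fun x κ => φ (x, κ)) (u - e ν) ν α else 0) +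
        (if a' = b then lcurl e (fun x κ => ψ (x, κ)) (u - e ν) ν α else 0) -
      ((if a' = a then lcurl e (fun x κ => φ (x, κ)) u ν α else 0) +
        (if a' = b then lcurl e (fun x κ => ψ (x, κ)) u ν α else 0)))) =
      (if a' = a then ∑ ν, (lcurl e (fun x κ => φ (x, κ)) (u - e ν) ν α - lcurl e (fun x κ => φ (x, κ)) u ν α) else 0) +
      (if a' = b then ∑ ν, (lcurl e (fun x κ => ψ (x, κ)) (u - e ν) ν α - lcurl e (fun x κ => ψ (x, κ)) u ν α) else 0) := by
    intro a'
    by_cases ha : a' = a <;> by_cases hb : a' = b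
    · simp only [if_pos ha, if_pos hb, Finset.sum_add_distrib, Finset.sum_sub_distrib]; ring
    · simp only [if_pos ha, if_neg hb, add_zero]
    · simp only [if_neg ha, if_pos hb, zero_add]
    · simp only [if_neg ha, if_neg hb, add_zero, sub_self, Finset.sum_const_zero]
  simp only [hsplit, add_mul, ite_mul, zero_mul, Finset.sum_add_distrib, Finset.sum_ite_eq', Finset.mem_univ, if_true]

end TestVectors

end Summit.QuantumFields.BalabanUV.Beta.WilsonReflectionFrame
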